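import Literature.AlgebraicGeometry.Frobenioids.IsometryWideSubcategoryPreFrobenioid
import Literature.AlgebraicGeometry.Frobenioids.PreFrobenioidPullbacks
import HarnessLib

/-!
# Frobenioids II, Example 3.3 (iii): the isometries of a Frobenioid form a Frobenioid over the zero monoid

Mochizuki, *The geometry of Frobenioids II: poly-Frobenioids*, Kyushu J. Math. **62** (2008)
401–460, §3, Example 3.3 (iii) p. 29: "a routine verification reveals that `A` satisfies the
conditions of [Mzk5], Definition 1.3, hence that `A` is a Frobenioid over the base category `D`,
which is, in fact, of group-like type" [cite: MochizukiFrdII2008, Ex 3.3 (iii) p.29].  PROOF-ONLY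
file (no definition): the routine verification, carried out once for the wide subcategory `𝒲` of
isometries of ANY Frobenioid `C → F_Φ` (structure `𝒲 → F_0`, abc-iut-L1-t6's
`PreFrobenioid.isometriesToElem`) in which base-isomorphic objects receive isometric pre-steps from a
common object (hypothesis `h1`, the isometric form of [FrdI] Def. 1.3 (i)(b)).  Every clause of
[FrdI] Def. 1.3 for `𝒲` is read off the corresponding clause for `C` through the dictionary of
`IsometryWideSubcategory.lean`: co-angular pre-steps of `𝒲` are isomorphisms, so (iii)(c) is
conjugation (with (iii)(c)-base from the commutativity of `O^▷`, [FrdI] Rem. 1.3.1), (iii)(d) is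
trivial over the zero monoid, (v)(b)(c) factor through identities, (vi) is `ψ⁻¹ φ ∈ O^×`; (i)(a)(c),
(ii), (iv), (vii) come from `C` (pattern of found's `FrTrIsFrobenioid.lean`, [FrdI] Thm. 5.1 (iii)).
-/

namespace Literature.AlgebraicGeometry.Frobenioids

open CategoryTheory Opposite

universe w v v' u u'

namespace PreFrobenioid

namespace Isometries

variable {D : Type u} [Category.{v} D] {Φ : Dᵒᵖ ⥤ CommMonCat.{w}}
  {C : Type u'} [Category.{v'} C] {F : C ⥤ ElemFrobenioid Φ}

/-- A Frobenius-trivial object of `C` is Frobenius-trivial in `𝒲` (its Frobenius endomorphisms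
`ζ(n)`, being of Frobenius type, are isometries). [cite: MochizukiFrdII2008, Ex 3.3 (iii) p.29] -/
theorem isFrobeniusTrivial_of (hP : IsPreFrobenioid Φ F) (A : WideSubcategory (isometricMorphisms F))
    (hA : IsFrobeniusTrivial F A.obj) : IsFrobeniusTrivial (isometriesToElem F) A := by
  obtain ⟨ζ, hζ⟩ := hA
  let ζ' : ℕ+ →* End A :=
    { toFun := fun n => ⟨End.asHom (ζ n), (hζ n).2.2.1.2⟩
      map_one' := WideSubcategory.hom_ext _ (by
        show End.asHom (ζ 1) = 𝟙 A.obj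
        rw [map_one]
        rfl)
      map_mul' := fun m n => WideSubcategory.hom_ext _ (by
        show End.asHom (ζ (m * n)) = End.asHom (ζ n) ≫ End.asHom (ζ m)
        rw [map_mul]
        rfl) }
  exact ⟨ζ', fun n => ⟨(hζ n).1, (hζ n).2.1, (isFrobeniusType_iff hP _).2 (hζ n).2.2⟩⟩

/-- **The isometries of a Frobenioid form a Frobenioid over the zero monoid** ([FrdII] Ex. 3.3 (iii)
"routine verification", in general form): if `C → F_Φ` is a Frobenioid in which base-isomorphic
objects receive isometric pre-steps from a common object, then `𝒲 → F_0` satisfies all conditions of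
[FrdI] Def. 1.3. [cite: MochizukiFrdII2008, Ex 3.3 (iii) p.29] -/
theorem isFrobenioid_of (hF : IsFrobenioid F)
    (h1 : ∀ (A B : C) (α : baseObj F A ≅ baseObj F B), ∃ (X : C) (φ : X ⟶ A) (ψ : X ⟶ B),
      IsIsometricPreStep F φ ∧ IsIsometricPreStep F ψ ∧ Base F φ ≫ α.hom = Base F ψ) :
    IsFrobenioid (isometriesToElem F) := by
  have hP : IsPreFrobenioid Φ F := hF.isPreFrobenioid
  refine
    { isPreFrobenioid := isPreFrobenioid hF h1
      i_a := ?_, i_b := ?_, i_c := ?_, ii_exists := ?_, ii_unique := ?_, iii_a := ?_, iii_b := ?_,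
      iii_c := ?_, iii_c_base := ?_, iii_d_under_full := ?_, iii_d_under_surj := ?_,
      iii_d_over_full := ?_, iii_d_over_surj := ?_, iv_a_exists := ?_, iv_a_unique := ?_, iv_b := ?_,
      v_a := ?_, v_b_exists := ?_, v_b_unique := ?_, v_c_exists := ?_, v_c_unique := ?_, vi := ?_,
      vii_a := ?_, vii_b := ?_ }
  -- (i)(a)
  · intro A₀
    obtain ⟨A, hA, ⟨e⟩⟩ := hF.i_a A₀
    exact ⟨⟨A⟩, isFrobeniusTrivial_of hP ⟨A⟩ hA, ⟨e⟩⟩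
  -- (i)(b): the hypothesis `h1`
  · intro A B α
    obtain ⟨X, φ, ψ, hφ, hψ, hb⟩ := h1 A.obj B.obj α
    exact ⟨⟨X⟩, ⟨φ, hφ.1⟩, ⟨ψ, hψ.1⟩, hφ.2, hψ.2, hb⟩
  -- (i)(c)
  · intro A
    haveI := pullbackSliceToBase_faithful (isometriesToElem F) A
    haveI := pullbackSliceToBase_full (isometriesToElem F) A
    haveI : (pullbackSliceToBase (isometriesToElem F) A).EssSurj := by
      refine ⟨fun Y₀ => ?_⟩
      let f : Y₀.left ⟶ baseObj F A.obj := Y₀.hom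
      obtain ⟨X, ψ, i, hψ, hw⟩ := exists_isPullbackMorphism_over hF A f
      exact ⟨Over.mk (⟨ψ, isPullbackMorphism_of_val hP ψ hψ⟩ :
          (⟨X⟩ : PullbackCat (isometriesToElem F)) ⟶ ⟨A⟩), ⟨Over.isoMk i hw.symm⟩⟩
    exact {}
  -- (ii) existence
  · intro A n
    obtain ⟨B, φ, hφ, hn⟩ := hF.ii_exists A.obj n
    exact ⟨⟨B⟩, ⟨φ, hφ.1.2⟩, (isFrobeniusType_iff hP _).2 hφ, hn⟩
  -- (ii) uniqueness
  · intro A B B' φ ψ hφ hψ hn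
    obtain ⟨β, hβ⟩ := hF.ii_unique φ.1 ψ.1 ((isFrobeniusType_iff hP φ).1 hφ)
      ((isFrobeniusType_iff hP ψ).1 hψ) hn
    obtain ⟨j, hj⟩ := nonempty_iso_of_iso hP (X := B) (Y := B') β
    refine ⟨j, WideSubcategory.hom_ext _ ?_⟩
    rw [WideSubcategory.comp_def, hj]
    exact hβ
  -- (iii)(a)
  · intro X Y Z f g hf hg
    exact isCoAngular_of_val hP _
      (IsCoAngular.comp F hF (isCoAngular_val hP f hf) (isCoAngular_val hP g hg))
  -- (iii)(b)
  · intro A' A φ hφ ψ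
    haveI : IsIso φ := isIso_of_isCoAngularPreStep hF φ hφ
    have h : IsCoAngular F (φ ≫ inv φ ≫ ψ).1 :=
      IsCoAngular.comp F hF (isCoAngular_val hP φ hφ.1)
        (isCoAngular_val hP _ (isCoAngular_endo hF (inv φ ≫ ψ)))
    rw [IsIso.hom_inv_id_assoc] at h
    exact isCoAngular_of_val hP ψ h
  -- (iii)(c)
  · intro A B φ hφ
    haveI : IsIso φ := isIso_of_isCoAngularPreStep hF φ hφ
    exact ⟨endSubmonoidConj (isometriesToElem F) (asIso φ), hom_comp_endSubmonoidConj (asIso φ)⟩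
  -- (iii)(c), dependence on `Base(φ)`
  · intro A B φ φ' hφ hφ' hb α β β' e₁ e₂
    haveI : IsIso φ := isIso_of_isCoAngularPreStep hF φ hφ
    haveI : IsIso φ' := isIso_of_isCoAngularPreStep hF φ' hφ'
    haveI : IsIso φ.1 := isIso_val φ
    haveI : IsIso φ'.1 := isIso_val φ'
    have hb' : Base F φ.1 = Base F φ'.1 := hb
    have e₁v : φ.1 ≫ β.1.1 = α.1.1 ≫ φ.1 := congrArg (·.hom) e₁
    have e₂v : φ'.1 ≫ β'.1.1 = α.1.1 ≫ φ'.1 := congrArg (·.hom) e₂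
    -- `w := φ⁻¹ φ'` lies in `O^▷(B)` (in `C`), hence commutes with `β` there (Remark 1.3.1)
    have hwb : Base F (inv φ.1 ≫ φ'.1) = 𝟙 _ := by
      rw [base_comp, ← hb', ← base_comp, IsIso.inv_hom_id, base_id]
    have hwl : degFr F (inv φ.1 ≫ φ'.1) = 1 := by
      rw [degFr_comp, show degFr F φ'.1 = 1 from hφ'.2.1, mul_one]
      exact isLinear_of_isIso F (inv φ.1)
    have hβb : Base F β.1.1 = 𝟙 _ := β.2.1
    have hβl : degFr F β.1.1 = 1 := β.2.2
    have hcomm : (inv φ.1 ≫ φ'.1) ≫ β.1.1 = β.1.1 ≫ inv φ.1 ≫ φ'.1 :=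
      congrArg Subtype.val (endSubmonoid_comm F hF ⟨β.1.1, ⟨hβb, hβl⟩⟩ ⟨inv φ.1 ≫ φ'.1, ⟨hwb, hwl⟩⟩)
    have hα : α.1.1 = φ.1 ≫ β.1.1 ≫ inv φ.1 := by
      rw [← Category.assoc, e₁v, Category.assoc, IsIso.hom_inv_id, Category.comp_id]
    have hβ' : β'.1.1 = inv φ'.1 ≫ α.1.1 ≫ φ'.1 := by
      rw [← e₂v, IsIso.inv_hom_id_assoc]
    apply Subtype.ext
    apply WideSubcategory.hom_ext _
    show β.1.1 = β'.1.1
    rw [hβ', hα]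
    simp only [Category.assoc]
    rw [← hcomm]
    simp only [Category.assoc, IsIso.hom_inv_id_assoc, IsIso.inv_hom_id_assoc]
  -- (iii)(d), coslice, full
  · intro A B B' φ φ' hφ hφ' _
    haveI : IsIso φ := isIso_of_isCoAngularPreStep hF φ hφ
    haveI : IsIso φ' := isIso_of_isCoAngularPreStep hF φ' hφ'
    exact ⟨inv φ ≫ φ', isCoAngularPreStep_of_isIso hP _, by rw [IsIso.hom_inv_id_assoc]⟩
  -- (iii)(d), coslice, essentially surjective
  · intro A x
    exact ⟨A, 𝟙 A, isCoAngularPreStep_of_isIso hP _, Subsingleton.elim _ _⟩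
  -- (iii)(d), slice, full
  · intro A B B' ψ ψ' hψ hψ' _
    haveI : IsIso ψ := isIso_of_isCoAngularPreStep hF ψ hψ
    haveI : IsIso ψ' := isIso_of_isCoAngularPreStep hF ψ' hψ'
    exact ⟨ψ ≫ inv ψ', isCoAngularPreStep_of_isIso hP _,
      by rw [Category.assoc, IsIso.inv_hom_id, Category.comp_id]⟩
  -- (iii)(d), slice, essentially surjective
  · intro A x
    exact ⟨A, 𝟙 A, isCoAngularPreStep_of_isIso hP _, Subsingleton.elim _ _⟩
  -- (iv)(a) existence
  · intro A B φ
    obtain ⟨X, Y, γ, β, α, hfac, hγ, hβ, hα⟩ := hF.iv_a_exists φ.1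
    have hαi : IsIsometry F α := (hF.iv_b α hα).1.2
    have hγi : IsIsometry F γ := hγ.1.2
    have hφi : IsIsometry F (γ ≫ β ≫ α) := by rw [hfac]; exact φ.2
    have hβi : IsIsometry F β := (isIsometry_factors F hP (isIsometry_factors F hP hφi).1).2
    let X₁ : WideSubcategory (isometricMorphisms F) := ⟨X⟩
    let Y₁ : WideSubcategory (isometricMorphisms F) := ⟨Y⟩
    let γ₁ : A ⟶ X₁ := ⟨γ, hγi⟩
    let β₁ : X₁ ⟶ Y₁ := ⟨β, hβi⟩
    let α₁ : Y₁ ⟶ B := ⟨α, hαi⟩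
    exact ⟨X₁, Y₁, γ₁, β₁, α₁, WideSubcategory.hom_ext _ hfac, (isFrobeniusType_iff hP γ₁).2 hγ, hβ,
      isPullbackMorphism_of_val hP α₁ hα⟩
  -- (iv)(a) uniqueness
  · intro A B X Y X' Y' φ γ β α γ' β' α' h hγ hβ hα h' hγ' hβ' hα'
    obtain ⟨ε, δ, h₁, h₂, h₃⟩ := hF.iv_a_unique φ.1 γ.1 β.1 α.1 γ'.1 β'.1 α'.1
      (congrArg (·.hom) h) ((isFrobeniusType_iff hP γ).1 hγ) hβ (isPullbackMorphism_val hF α hα)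
      (congrArg (·.hom) h') ((isFrobeniusType_iff hP γ').1 hγ') hβ'
      (isPullbackMorphism_val hF α' hα')
    obtain ⟨ε₁, hε₁⟩ := nonempty_iso_of_iso hP (X := X) (Y := X') ε
    obtain ⟨δ₁, hδ₁⟩ := nonempty_iso_of_iso hP (X := Y) (Y := Y') δ
    refine ⟨ε₁, δ₁, WideSubcategory.hom_ext _ ?_, WideSubcategory.hom_ext _ ?_,
      WideSubcategory.hom_ext _ ?_⟩
    · rw [WideSubcategory.comp_def, hε₁]; exact h₁
    · rw [WideSubcategory.comp_def, WideSubcategory.comp_def, hδ₁, hε₁]; exact h₂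
    · rw [WideSubcategory.comp_def, hδ₁]; exact h₃
  -- (iv)(b)
  · intro A B φ hφ
    obtain ⟨⟨hco, _⟩, hlin⟩ := hF.iv_b φ.1 (isPullbackMorphism_val hF φ hφ)
    exact ⟨⟨isCoAngular_of_val hP φ hco, isIsometry φ⟩, hlin⟩
  -- (v)(a)
  · intro A B φ hφ
    haveI : Mono φ.1 := hF.v_a φ.1 hφ
    exact ⟨fun g h e => WideSubcategory.hom_ext _ ((cancel_mono φ.1).mp (congrArg (·.hom) e))⟩
  -- (v)(b) existence: `φ = φ ∘ id`
  · intro A B φ hφ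
    exact ⟨A, 𝟙 A, φ, Category.id_comp φ, isCoAngularPreStep_of_isIso hP _, isIsometry φ, hφ⟩
  -- (v)(b) uniqueness
  · intro A B X X' φ β α β' α' e hβ _ e' hβ' _
    haveI : IsIso β := isIso_of_isCoAngularPreStep hF β hβ
    haveI : IsIso β' := isIso_of_isCoAngularPreStep hF β' hβ'
    refine ⟨(asIso β).symm ≪≫ asIso β', ?_, ?_⟩
    · show β ≫ inv β ≫ β' = β'
      rw [IsIso.hom_inv_id_assoc]
    · show α = (inv β ≫ β') ≫ α'
      rw [Category.assoc, e', ← e, IsIso.inv_hom_id_assoc]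
  -- (v)(c) existence: `φ = id ∘ φ`
  · intro A B φ hφ
    exact ⟨B, φ, 𝟙 B, Category.comp_id φ, ⟨isIsometry φ, hφ⟩, isCoAngularPreStep_of_isIso hP _⟩
  -- (v)(c) uniqueness
  · intro A B X X' φ β α β' α' e _ hα e' _ hα'
    haveI : IsIso α := isIso_of_isCoAngularPreStep hF α hα
    haveI : IsIso α' := isIso_of_isCoAngularPreStep hF α' hα'
    refine ⟨asIso α ≪≫ (asIso α').symm, ?_, ?_⟩
    · show β ≫ α ≫ inv α' = β'
      rw [← Category.assoc, e, ← e', Category.assoc, IsIso.hom_inv_id, Category.comp_id]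
    · show α = (α ≫ inv α') ≫ α'
      rw [Category.assoc, IsIso.inv_hom_id, Category.comp_id]
  -- (vi)
  · intro A B φ ψ hφ hψ hb _
    haveI : IsIso φ := isIso_of_isCoAngularPreStep hF φ hφ
    haveI : IsIso ψ := isIso_of_isCoAngularPreStep hF ψ hψ
    have hb' : Base F φ.1 = Base F ψ.1 := hb
    let a : B ⟶ B := inv ψ ≫ φ
    have ha : ψ ≫ a = φ := by rw [IsIso.hom_inv_id_assoc]
    have hab : IsBaseIdentity (isometriesToElem F) a := by
      haveI := hP.isTotallyEpimorphic_base.epi (Base F ψ.1)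
      apply (cancel_epi (Base F ψ.1)).mp
      show Base F ψ.1 ≫ Base F a.1 = Base F ψ.1 ≫ 𝟙 _
      rw [← base_comp, show ψ.1 ≫ a.1 = (ψ ≫ a).1 from rfl, ha, Category.comp_id, hb']
    exact ⟨asIso a, ⟨hab, isLinear_of_isIso (isometriesToElem F) a⟩, ha⟩
  -- (vii)(a): the isotropic hull of `C`
  · intro A
    obtain ⟨B, φ, hφ⟩ := hF.vii_a A.obj
    let B₁ : WideSubcategory (isometricMorphisms F) := ⟨B⟩
    let φ₁ : A ⟶ B₁ := ⟨φ, hφ.1⟩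
    refine ⟨B₁, φ₁, isIsometry φ₁, hφ.2.1, (isIsotropic_iff hP B₁).2 hφ.2.2.1, fun C' γ hC' => ?_⟩
    obtain ⟨β, hβ, huniq⟩ := hφ.2.2.2 γ.1 ((isIsotropic_iff hP C').1 hC')
    have hβi : IsIsometry F β :=
      (isIsometry_factors F hP (show IsIsometry F (φ ≫ β) by rw [hβ]; exact γ.2)).1
    exact ⟨⟨β, hβi⟩, WideSubcategory.hom_ext _ hβ,
      fun β' hβ' => WideSubcategory.hom_ext _ (huniq β'.1 (congrArg (·.hom) hβ'))⟩
  -- (vii)(b)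
  · intro A B φ hA
    exact (isIsotropic_iff hP B).2 (hF.vii_b φ.1 ((isIsotropic_iff hP A).1 hA))

end Isometries

end PreFrobenioid

end Literature.AlgebraicGeometry.Frobenioids
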